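import Literature.Claims.NS.ArandaIcardo2025
import Summits.NavierStokesRegularity.NavierStokesRegularity.Theorems.SoloRefuteBaev2022Cond11
import Literature.Analysis.FluidPDE.PressurePoisson
import Literature.Analysis.PDE.HarmonicSmoothLiouville
import HarnessLib

/-!
# C98 `ArandaIcardo2025` — kernel facts for the verdict (cell ns-claims, D-0090)

Skeleton: `Literature.Claims.NS.ArandaIcardo2025` (typist-3 g3, p490802), typing A. Aranda Icardo,
*A proposed solution to the smoothness and existence of the Navier–Stokes equations in three
dimensions*, Research Square rs-6464661/v1 (2025).  This file records, sorry-free, what the kernel can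
say about the typed chain:

* **The data class of the existence claim is the zero datum.**  `isDatum_convectiveZero_iff`:
  a smooth, divergence-free, rapidly decreasing field `u₀` on `ℝ³` (Clay (4)) with the added
  hypothesis of §4 p.3 l.1–2 / §5 p.5 l.71–72 «(u·∇)u = 0 at t = 0» (`ConvectiveZero`) is `0`
  (re-export, by definitional unfolding, of
  `Summit.NavierStokesRegularity.NavierStokesRegularity.Theorems.Baev2022.isDatum_cond11_iff`,
  refuter-2's C113 addendum p490675 — `IsDatum`/`ConvectiveZero` are verbatim `Baev2022.IsDatum`/`Cond11`).
  Hence `claimedExistence_holds`: the typed `ClaimedExistence` (§5 p.5 l.58–73, (A)-shaped on the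
  restricted class Δ4) is TRUE, witnessed by the rest state `u ≡ 0`, `p ≡ 0`, and says nothing about
  any non-zero Clay datum — the class is VACUOUS for Clay (A).
* **Step 3 (uniqueness of the Taylor coefficients, §3 p.2) is TRUE in the kernel**:
  `taylor_velocity_unique` / `step_3_holds` — two systems (4)–(5) for the same `(ν, u₀)` have the
  same velocity coefficients (induction on `h`; the pressure difference is `C²`, harmonic because
  `div u_{h+1} = 0`, with gradient `→ 0` at infinity, hence constant by the tree's Liouville lemma
  `Literature.Analysis.PDE.isConst_of_harmonic_of_tendsto_gradient`, as in salvage-p1's C113 discharge).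
* **Step 4 (convergence under `(u₀·∇)u₀ = 0`, §4 pp.3–4) is TRUE in the kernel, for the reason that
  its data class is `{0}`**: `taylorSystem_zero_datum` — every Taylor system for the zero datum is
  identically zero — so the majorant argument of §4 is never exercised (`step_4_holds`).
* Consequently the uniqueness conclusion rides on the ANSATZ alone:
  `claimedUniqueness_of_step_1 : Step_1 → ClaimedUniqueness` (Step 1 = p.1 l.51–60, every smooth
  bounded-energy solution equals its formal time-power series at `t = 0` for all `t ≥ 0`; not
  derived in print; no kernel countermodel is offered here — it would require an explicit non-zero
  global Clay-class flow).

Per-step table (typed decl → status here): `ConvectiveZero`-class = `{0}` (kernel) · `ClaimedExistence`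
TRUE/vacuous (kernel) · `Step_1` not decided (load-bearing for `ClaimedUniqueness`) · `Step_2` not
decided (TRUE-type) · `Step_3` TRUE (kernel) · `Step_4` TRUE (kernel, vacuous class) · `Step_5` not
decided · `Step_6`, `Step_7` not decided (TRUE-type, hedged in print) · `ClaimedUniqueness` not decided
(direction OTHER) · `ClaimedDecay` not decided.

Refuter-3 (cell ns-claims), 2026-08-27; credits: typist-3 g3 (skeleton and decl index), refuter-2
(`isDatum_cond11_iff`, `eq_zero_of_convect_self_eq_zero_of_decay`), salvage-p1 g2 (Liouville discharge
pattern).  WHAT THIS IS NOT: not a claim about NS regularity or blow-up; not a claim about any author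
beyond the typed locator.
-/

noncomputable section

-- the summit-side namespace repeats a component by design (D-0017)
set_option linter.dupNamespace false

namespace Summit.NavierStokesRegularity.NavierStokesRegularity.Theorems.ArandaIcardo2025

open Set Filter Topology MeasureTheory
open scoped ContDiff ENNReal Laplacian
open Literature.Analysis.FluidPDE Literature.Analysis.PDE Literature.Claims.NS.ArandaIcardo2025

/-! ## The data class of §4–§5 is the zero datum; the existence claim holds vacuously -/

/-- **The restricted data class is `{0}`**: a smooth, divergence-free, rapidly decreasing field on `ℝ³`
with `(u₀·∇)u₀ ≡ 0` vanishes identically, and `0` is such a field (verbatim re-export of the C113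
lemma `Baev2022.isDatum_cond11_iff`). [cite: ArandaIcardo2025, §4 p.3 l.1–2; §5 p.5 l.71–72] -/
theorem isDatum_convectiveZero_iff (u₀ : E3 → E3) : IsDatum u₀ ∧ ConvectiveZero u₀ ↔ u₀ = 0 :=
  Baev2022.isDatum_cond11_iff u₀

/-- The zero velocity field has bounded energy (Clay (7) with `C = 0`). [folklore] -/
theorem hasBoundedEnergy_zero : HasBoundedEnergy (0 : ℝ → E3 → E3) :=
  ⟨0, ENNReal.zero_lt_top, fun t _ => by simp⟩

/-- The rest state `u ≡ 0`, `p ≡ 0` is a smooth bounded-energy solution of (1)–(3) with `f ≡ 0` from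
the zero datum, at every viscosity. [folklore] -/
theorem isGlobalSolution_zero (ν : ℝ) : IsGlobalSolution ν 0 0 0 := by
  obtain ⟨h1, h2, h3⟩ := isNavierStokesSolution_zero (E := E3) ν
  exact ⟨h2, h3, h1, hasBoundedEnergy_zero⟩

/-- **The claimed existence (§5) is TRUE — vacuously**: its only datum is `0`
(`isDatum_convectiveZero_iff`), served by the rest state.  The sentence carries no information on
Clay (A). [cite: ArandaIcardo2025, §5 p.5 l.58–73] -/
theorem claimedExistence_holds : Literature.Claims.NS.ArandaIcardo2025.ClaimedExistence := by
  intro ν _ u₀ hd hc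
  obtain rfl : u₀ = 0 := (isDatum_convectiveZero_iff u₀).1 ⟨hd, hc⟩
  exact ⟨0, 0, isGlobalSolution_zero ν⟩

/-! ## Step 3 is TRUE: the recursion (4)–(5) determines the velocity coefficients -/

/-- Gradient of a pointwise difference at a point of differentiability. [folklore] -/
theorem gradient_fun_sub_apply {f g : E3 → ℝ} {x : E3} (hf : DifferentiableAt ℝ f x)
    (hg : DifferentiableAt ℝ g x) : gradient (fun y => f y - g y) x = gradient f x - gradient g x := by
  simp only [gradient, fderiv_fun_sub hf hg, map_sub]

/-- **Uniqueness of the velocity coefficients** (Step 3, §3 p.2 l.35–39, l.54–55): two Taylor systems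
(4)–(5) for the same `(ν, u₀)` have the same `u_h` for every `h`.  Induction on `h`: the momentum
identities (4) at order `h` differ only in the pressure term, so `(h+1)(u_{h+1} − u'_{h+1}) =
−∇(p_h − p'_h)`; by (5) `p_h − p'_h` is harmonic, its gradient tends to `0` at infinity (the typed
Newtonian-potential selection), so it is constant (Liouville) and `u_{h+1} = u'_{h+1}`.
[cite: ArandaIcardo2025, §3 p.2 l.35–39, l.54–55] -/
theorem taylor_velocity_unique {ν : ℝ} {u₀ : E3 → E3} {U U' : ℕ → E3 → E3} {P P' : ℕ → E3 → ℝ}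
    (hT : IsTaylorSystem ν u₀ U P) (hT' : IsTaylorSystem ν u₀ U' P') : U = U' := by
  have key : ∀ n h : ℕ, h ≤ n → U h = U' h := by
    intro n
    induction n with
    | zero =>
      intro h hh
      obtain rfl : h = 0 := Nat.le_zero.1 hh
      rw [hT.initial, hT'.initial]
    | succ n ih =>
      intro h hh
      rcases Nat.lt_or_ge h (n + 1) with hlt | hge
      · exact ih h (Nat.lt_succ_iff.1 hlt)
      obtain rfl : h = n + 1 := le_antisymm hh hge
      -- the sums and the Laplacian terms of (4) at order `n` coincide
      have hsum : ∀ x : E3, ∑ g ∈ Finset.range (n + 1), convect (U g) (U (n - g)) x =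
          ∑ g ∈ Finset.range (n + 1), convect (U' g) (U' (n - g)) x := fun x =>
        Finset.sum_congr rfl fun g hg => by
          rw [ih g (Nat.lt_succ_iff.1 (Finset.mem_range.1 hg)), ih (n - g) (Nat.sub_le n g)]
      have hUn : U n = U' n := ih n le_rfl
      -- (4) at order `n`, subtracted
      have hdiff : ∀ x : E3, ((n : ℝ) + 1) • (U (n + 1) x - U' (n + 1) x) =
          -(gradient (P n) x - gradient (P' n) x) := fun x => by
        have e1 := hT.momentum n x
        have e2 := hT'.momentum n x
        rw [hsum x, hUn] at e1
        have a1 := eq_sub_of_add_eq e1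
        have a2 := eq_sub_of_add_eq e2
        rw [smul_sub, a1, a2]
        abel
      -- the pressure difference
      set q : E3 → ℝ := fun y => P n y - P' n y with hq
      have hPs : ContDiff ℝ ∞ (P n) := hT.smooth_pressure n
      have hP's : ContDiff ℝ ∞ (P' n) := hT'.smooth_pressure n
      have hq2 : ContDiff ℝ 2 q := contDiff_infty.1 (hPs.sub hP's) 2
      have hPd : Differentiable ℝ (P n) := hPs.differentiable (by simp)
      have hP'd : Differentiable ℝ (P' n) := hP's.differentiable (by simp)
      have hgq : ∀ x : E3, gradient q x = gradient (P n) x - gradient (P' n) x := fun x =>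
        gradient_fun_sub_apply (hPd x) (hP'd x)
      have hgqU : ∀ x : E3, gradient q x = -(((n : ℝ) + 1) • (U (n + 1) x - U' (n + 1) x)) :=
        fun x => by rw [hgq x, hdiff x, neg_neg]
      -- `q` is harmonic: `Δq = div ∇q = -(n+1) (div u_{n+1} - div u'_{n+1}) = 0`
      have hUs : ContDiff ℝ ∞ (U (n + 1)) := hT.smooth_velocity (n + 1)
      have hU's : ContDiff ℝ ∞ (U' (n + 1)) := hT'.smooth_velocity (n + 1)
      have hUd : Differentiable ℝ (U (n + 1)) := hUs.differentiable (by simp)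
      have hU'd : Differentiable ℝ (U' (n + 1)) := hU's.differentiable (by simp)
      have hΔ : ∀ x : E3, Δ q x = 0 := fun x => by
        rw [← divergence_gradient hq2 x]
        have hfun : gradient q =
            fun y => (-((n : ℝ) + 1)) • (fun z => U (n + 1) z - U' (n + 1) z) y := by
          funext y
          rw [hgqU y, neg_smul]
        have hv : DifferentiableAt ℝ (fun z => U (n + 1) z - U' (n + 1) z) x :=
          (hUd x).sub (hU'd x)
        rw [hfun, divergence_const_smul_apply hv, divergence_sub_apply (hUd x) (hU'd x)]
        have h1 : VectorCalculus.divergence (U (n + 1)) x = 0 := hT.divFree (n + 1) x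
        have h2 : VectorCalculus.divergence (U' (n + 1)) x = 0 := hT'.divFree (n + 1) x
        rw [h1, h2, sub_zero, mul_zero]
      -- its gradient tends to `0` at infinity
      have hg : Tendsto (gradient q) (cocompact E3) (𝓝 0) := by
        have h := (hT.pressure_decay n).sub (hT'.pressure_decay n)
        rw [sub_zero] at h
        refine h.congr' (Eventually.of_forall fun x => ?_)
        exact (hgq x).symm
      -- Liouville: `q` is constant, so its gradient vanishes
      have hconst : q = fun _ => q 0 := funext fun x => isConst_of_harmonic_of_tendsto_gradient hq2 hΔ hg x 0
      funext x
      have hzero : gradient q x = 0 := by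
        rw [hconst]
        exact gradient_fun_const x (q 0)
      rw [hgqU x, neg_eq_zero, smul_eq_zero] at hzero
      rcases hzero with hn | hx
      · exact absurd hn (by positivity)
      · exact sub_eq_zero.1 hx
  funext h
  exact key h h le_rfl

/-- **Step 3 of the skeleton holds** (coefficient uniqueness, §3 p.2). [cite: ArandaIcardo2025, §3 p.2 l.35–39, l.54–55] -/
theorem step_3_holds : Literature.Claims.NS.ArandaIcardo2025.Step_3 :=
  fun _ _ _ _ _ _ _ _ hT hT' => taylor_velocity_unique hT hT'

/-! ## Step 4 is TRUE because its data class is `{0}` -/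

/-- The zero system `u_h ≡ 0`, `p_h ≡ 0` is a Taylor system (4)–(5) for the zero datum. [folklore] -/
theorem isTaylorSystem_zero (ν : ℝ) :
    IsTaylorSystem ν 0 (fun _ _ => (0 : E3)) (fun _ _ => (0 : ℝ)) where
  initial := rfl
  smooth_velocity := fun _ => contDiff_const
  smooth_pressure := fun _ => contDiff_const
  momentum := fun h x => by
    simp [convect, gradient_fun_const]
  divFree := fun h x => by
    rw [NSWave0.divergence, fderiv_const_apply]
    simp
  pressure_decay := fun h => by
    simp [gradient_fun_const]

/-- **Every Taylor system for the zero datum is identically zero** (by `taylor_velocity_unique`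
against the zero system). [folklore] -/
theorem taylorSystem_zero_datum {ν : ℝ} {U : ℕ → E3 → E3} {P : ℕ → E3 → ℝ}
    (hT : IsTaylorSystem ν 0 U P) : U = fun _ _ => (0 : E3) :=
  taylor_velocity_unique hT (isTaylorSystem_zero ν)

/-- **Step 4 of the skeleton holds**: under `(u₀·∇)u₀ = 0` the datum is `0`
(`isDatum_convectiveZero_iff`), every Taylor system is `0` (`taylorSystem_zero_datum`), and the
velocity series is the zero series — the majorant argument of §4 pp.3–4 is never exercised.
[cite: ArandaIcardo2025, §4 p.3 l.1–59; p.3 l.60–p.4 l.76] -/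
theorem step_4_holds : Literature.Claims.NS.ArandaIcardo2025.Step_4 := by
  intro ν _ u₀ hd hc U P hT t x
  obtain rfl : u₀ = 0 := (isDatum_convectiveZero_iff u₀).1 ⟨hd, hc⟩
  rw [taylorSystem_zero_datum hT]
  simp

/-! ## What the chains reduce to -/

/-- **The uniqueness conclusion rides on the ansatz alone**: with Step 3 in the kernel,
`claimU_of_steps` reads `Step_1 → ClaimedUniqueness` (Step 1 = p.1 l.51–60, every solution is the sum
of its time-power series at `t = 0` for all `t ≥ 0`). [cite: ArandaIcardo2025, §2 p.1 l.51–60; §3 p.2 l.54–64] -/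
theorem claimedUniqueness_of_step_1 (h₁ : Literature.Claims.NS.ArandaIcardo2025.Step_1) :
    Literature.Claims.NS.ArandaIcardo2025.ClaimedUniqueness :=
  claimU_of_steps h₁ step_3_holds

end Summit.NavierStokesRegularity.NavierStokesRegularity.Theorems.ArandaIcardo2025

end

-- WHAT THIS IS NOT: not a claim about NS regularity or blow-up; not a claim about any author beyond the
-- typed locator.
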